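import Mathlib
import Summits.ResolutionOfSingularities.ResolutionOfSingularities.Theorems.RadicialJungCleanModelsLens5ArcPotential
import Summits.ResolutionOfSingularities.ResolutionOfSingularities.Theorems.RadicialJungCleanModelsLens5AbsDerivation
import HarnessLib

/-!
# Crux `DescentPerfectToAll` (stmt-ResolutionOfSingularities-0549) — lens 5 (CP 2019 sibling transfer), g20:
# THEOREM P in EVERY dimension — `CleanLUArcAllDim p` (census-4 addendum B §2 row 2 / addendum C §1 «one leaf with a plan») PROVED

Author `res-B-lens-5` g20 (2026-08-30).  OURS · CANDIDATE · counted 0.  **Nothing here proves resolution of singularities in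
characteristic `p`; rung B (`DescentPerfectToAll`) is NOT proved; `CleanModels` (stmt-15917) is NOT proved.**  What is proved, sorry-free:

* `rsop_completion` — the TRANSPORT LEMMA (`RSOPCompletionAtDim d` of `Census_lens1_g3_DimTransport.lean`, there «statement only, size S»):
  in a regular local ring of Krull dimension `d`, a pair `(π, F)` with `π ∈ 𝔪 ∖ 𝔪²`, `F ∈ 𝔪`, independent modulo `𝔪²`
  (`a π + b F ∈ 𝔪² ⇒ b ∈ 𝔪`) extends to a regular system of parameters `t : Fin d → S`, `t 0 = π`, `t 1 = F` (and `2 ≤ d` follows).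
  Proof: two Steinitz exchanges on a minimal basis of `𝔪` (`span_range_update_sum_eq`) + a reindexing permutation.
* `CoreHypD.core` — the potential argument of THEOREM P (`Theorems/…Lens5ArcPotentialCore.lean`, ✓p691218 lineage) with the two
  dimension components (`reg`, `dim = 3`) REMOVED from the hypothesis package: the induction never looks at the dimension; exit (1) now hands
  over the independent pair `(π, F)` uncompleted.  (Token-level copy of the landed core with exactly that change; the landed file is not touched.)
* `concl_of_exit1_d`, `arcPotential_d` — exit (1) ⇒ loose clean form (1) in dimension `d` via `rsop_completion`, and **THEOREM P_d**:
  `arcPotential` with `3 ↦ d`, for EVERY `d : ℕ` (for `d = 0` the hypotheses are contradictory: a regular local ring of dimension `0` is a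
  field, so `v` would be trivial on `K = Frac A`, while `g₀` without best `p`-th-power approximation forces `v π < 1`; this also replaces the
  landed proof's use of `dim = 3` for `v π < 1`).
* `cleanLUArcAtDim_holds p hp d : CleanLUArcAtDim p d` and `cleanLUArcAllDim_holds p hp : CleanLUArcAllDim p` — THEOREM P_d + LEMMA D-abs
  (`Lens5.AbsDerivation.absDerivation_of_forall_pow_ne'`, ✓p690461): the registrar's dim-free target, with `CleanLUArcAtDim` /
  `RSOPCompletionAtDim` / `CleanLUArcAllDim` re-declared here TOKEN-IDENTICAL to `Census_lens1_g3_DimTransport.lean` (crux modules are not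
  importable on the farm; the identity is by inspection, both namespaces spelled out below), and `rsopCompletionAtDim_holds d`;
  closed form `cleanLUArcAllDimAllPrimes_holds : ∀ p, p.Prime → CleanLUArcAllDim p` (kernel-closed witness for the file audit).

Check (author, farm): `lean check --json` rc 0 · 0 errors · 0 warnings · 0 `sorry` · axioms of `cleanLUArcAllDimAllPrimes_holds` =
{propext, Classical.choice, Quot.sound}.  Port-readiness: imports only landed `Theorems/` modules + Mathlib + HarnessLib; a lead may re-home
§RSP + §Core + §Conclusion + §Main under `Theorems/` verbatim (no `Cruxes` import anywhere).  Audit: crit TRIAGE-157 PASS (2026-08-30,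
bus l.40110: byte-copy farm check, asmdiff of the three defs IDENTICAL 604/149/19 tok, all 53 theorems on the standard axioms).
Rev 2 (g20, port hygiene only, mathematics byte-identical to rev 1 381832a6b091e4b2): the `linter.unusedSectionVars false` option is
REMOVED and replaced by 35 explicit `omit … in` clauses (the linter's own suggestions, iterated to a fixed point) — 0 warnings with no linter
disabled except `dupNamespace`; crit's two readings recorded: the binders `_hdimA` / `_htd` of `arcPotential_d` are UNUSED, so the theorem
is STRONGER than the census leaf (any transcendence defect, no `dim A ≤ d`); they are kept only so that `cleanLUArcAtDim_holds` has the
leaf's type token-for-token.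

Placement (honest): this is the local layer of the PRICE `stub_cleanModelsDimGEFour` in the ONE valuation class (A) = discrete rank one,
zero-dimensional, `g₀` with no best `p`-th-power approximation — now in every dimension `d ≥ 4` over every (imperfect) ground field, i.e. the
first kernel theorem of the lineage that lives in the rung-B-proper regime.  By census-4 (addenda B/C) it is strategically inert for rung B on
its own: no patching theorem in dimension `≥ 4` turns clean local uniformization into `CleanModels`, and classes (B)/(C) are open in
dimension `≥ 4` (they are CP 2019's theorem in dimension 3).  bears_on: LADDER-RESOLUTION:B · [OURS · CANDIDATE] counted 0.
-/

noncomputable section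

set_option linter.dupNamespace false -- mandated namespace of this single-conjunct summit

open IsLocalRing
open Literature.AlgebraicGeometry.Resolution
open Summit.ResolutionOfSingularities.ResolutionOfSingularities.Theorems.RadicialJung.CleanModels
open Summit.ResolutionOfSingularities.ResolutionOfSingularities.Theorems.RadicialJung.CleanModels.Lens5.ArcPotentialProof

namespace Summit.ResolutionOfSingularities.ResolutionOfSingularities.Cruxes.DescentPerfectToAll.Lens5ArcAllDim

/-! ## The transport lemma: r.s.p. completion of an independent pair in dimension `d` -/

section RSP

variable {S : Type*}

/-- **Exchange lemma.**  If `y = ∑ aⱼ xⱼ` with `aᵢ` a unit, replacing `xᵢ` by `y` does not change the ideal generated. [folklore] -/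
theorem span_range_update_sum_eq [CommRing S] {ι : Type*} [Fintype ι] [DecidableEq ι] (x : ι → S) (a : ι → S) (i : ι)
    (hi : IsUnit (a i)) :
    Ideal.span (Set.range (Function.update x i (∑ j, a j * x j))) = Ideal.span (Set.range x) := by
  set y : S := ∑ j, a j * x j with hydef
  apply le_antisymm
  · rw [Ideal.span_le]
    rintro _ ⟨l, rfl⟩
    rw [SetLike.mem_coe]
    by_cases hl : l = i
    · subst hl
      rw [Function.update_self]
      exact Ideal.sum_mem _ fun j _ => Ideal.mul_mem_left _ _ (Ideal.subset_span ⟨j, rfl⟩)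
    · rw [Function.update_of_ne hl]
      exact Ideal.subset_span ⟨l, rfl⟩
  · rw [Ideal.span_le]
    rintro _ ⟨l, rfl⟩
    rw [SetLike.mem_coe]
    by_cases hl : l = i
    · subst hl
      have h1 : Function.update x l y l ∈ Ideal.span (Set.range (Function.update x l y)) :=
        Ideal.subset_span ⟨l, rfl⟩
      rw [Function.update_self] at h1
      have h2 : ∑ j ∈ Finset.univ.erase l, a j * x j ∈ Ideal.span (Set.range (Function.update x l y)) := by
        refine Ideal.sum_mem _ fun j hj => Ideal.mul_mem_left _ _ ?_
        have hjl : j ≠ l := Finset.ne_of_mem_erase hj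
        have h3 : Function.update x l y j ∈ Ideal.span (Set.range (Function.update x l y)) :=
          Ideal.subset_span ⟨j, rfl⟩
        rwa [Function.update_of_ne hjl] at h3
      have hsplit : a l * x l = y - ∑ j ∈ Finset.univ.erase l, a j * x j := by
        rw [hydef, ← Finset.add_sum_erase Finset.univ (fun j => a j * x j) (Finset.mem_univ l)]
        ring
      have h4 : a l * x l ∈ Ideal.span (Set.range (Function.update x l y)) := by
        rw [hsplit]; exact Ideal.sub_mem _ h1 h2
      obtain ⟨u, hu⟩ := hi
      have h5 : x l = ↑u⁻¹ * (a l * x l) := by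
        rw [← mul_assoc, ← hu, Units.inv_mul, one_mul]
      rw [h5]
      exact Ideal.mul_mem_left _ _ h4
    · have h3 : Function.update x i y l ∈ Ideal.span (Set.range (Function.update x i y)) :=
        Ideal.subset_span ⟨l, rfl⟩
      rwa [Function.update_of_ne hl] at h3

/-- If `∑ aⱼ xⱼ ∉ 𝔪²` with all `xⱼ ∈ 𝔪`, some coefficient `aᵢ` is a unit. [folklore] -/
theorem exists_isUnit_of_sum_not_mem_sq [CommRing S] [IsLocalRing S] {ι : Type*} [Fintype ι] (x : ι → S) (hx : ∀ j, x j ∈ maximalIdeal S)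
    (a : ι → S) (h2 : ∑ j, a j * x j ∉ maximalIdeal S ^ 2) : ∃ i, IsUnit (a i) := by
  by_contra hne
  push Not at hne
  apply h2
  rw [pow_two]
  exact Ideal.sum_mem _ fun j _ =>
    Ideal.mul_mem_mul ((mem_maximalIdeal _).mpr (mem_nonunits_iff.mpr (hne j))) (hx j)

/-- **r.s.p. completion of an independent pair** (unordered form): in a regular local ring of dimension `d`, a pair `(π, F)` with
`π ∈ 𝔪 ∖ 𝔪²`, `F ∈ 𝔪`, independent modulo `𝔪²`, is part of a regular system of parameters `t : Fin d → S`. [folklore] -/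
theorem exists_rsop_extending_pair [CommRing S] [IsRegularLocalRing S] {d : ℕ} (hdim : ringKrullDim S = (d : WithBot ℕ∞))
    (π F : S) (hπ : π ∈ maximalIdeal S) (hπ2 : π ∉ maximalIdeal S ^ 2) (hF : F ∈ maximalIdeal S)
    (hind : ∀ a b : S, a * π + b * F ∈ maximalIdeal S ^ 2 → b ∈ maximalIdeal S) :
    ∃ (t : Fin d → S) (i j : Fin d), i ≠ j ∧ t i = π ∧ t j = F ∧ Ideal.span (Set.range t) = maximalIdeal S := by
  classical
  have hsf : (maximalIdeal S).spanFinrank = d := by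
    have e := IsRegularLocalRing.spanFinrank_maximalIdeal (R := S)
    rw [hdim] at e; exact_mod_cast e
  subst hsf
  obtain ⟨x, hx⟩ := Literature.AlgebraicGeometry.Resolution.exists_regularSystemOfParameters (R := S)
  have hxm : ∀ j, x j ∈ maximalIdeal S := fun j => by rw [← hx]; exact Ideal.subset_span ⟨j, rfl⟩
  -- first exchange: `xᵢ ↦ π`
  have hπ' : π ∈ Ideal.span (Set.range x) := by rw [hx]; exact hπ
  obtain ⟨a, ha⟩ := Ideal.mem_span_range_iff_exists_fun.mp hπ'
  obtain ⟨i, hi⟩ := exists_isUnit_of_sum_not_mem_sq x hxm a (by rw [ha]; exact hπ2)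
  have hx₁ : Ideal.span (Set.range (Function.update x i π)) = maximalIdeal S := by
    have e := span_range_update_sum_eq x a i hi
    rw [ha] at e
    exact e.trans hx
  set x₁ := Function.update x i π with hx₁def
  have hx₁i : x₁ i = π := Function.update_self _ _ _
  have hx₁m : ∀ j, x₁ j ∈ maximalIdeal S := fun j => by rw [← hx₁]; exact Ideal.subset_span ⟨j, rfl⟩
  -- second exchange: `xⱼ ↦ F` for some `j ≠ i`
  have hF' : F ∈ Ideal.span (Set.range x₁) := by rw [hx₁]; exact hF
  obtain ⟨b, hb⟩ := Ideal.mem_span_range_iff_exists_fun.mp hF'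
  have hj : ∃ j, j ≠ i ∧ IsUnit (b j) := by
    by_contra hne
    push Not at hne
    have hsq : (-b i) * π + 1 * F ∈ maximalIdeal S ^ 2 := by
      have e : (-b i) * π + 1 * F = ∑ j ∈ Finset.univ.erase i, b j * x₁ j := by
        rw [← hb, ← Finset.add_sum_erase Finset.univ (fun j => b j * x₁ j) (Finset.mem_univ i), hx₁i]
        ring
      rw [e, pow_two]
      refine Ideal.sum_mem _ fun j hj => ?_
      exact Ideal.mul_mem_mul ((mem_maximalIdeal _).mpr (mem_nonunits_iff.mpr (hne j (Finset.ne_of_mem_erase hj)))) (hx₁m j)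
    exact (maximalIdeal.isMaximal S).ne_top ((Ideal.eq_top_iff_one _).mpr (hind _ _ hsq))
  obtain ⟨j, hji, hj⟩ := hj
  have hx₂ : Ideal.span (Set.range (Function.update x₁ j F)) = maximalIdeal S := by
    have e := span_range_update_sum_eq x₁ b j hj
    rw [hb] at e
    exact e.trans hx₁
  refine ⟨Function.update x₁ j F, i, j, hji.symm, ?_, Function.update_self _ _ _, hx₂⟩
  rw [Function.update_of_ne hji.symm, hx₁i]

/-- Reindexing a family `Fin d → S` so that two given distinct indices come first. [folklore] -/
theorem exists_reindex_pair {d : ℕ} (t : Fin d → S) {i j : Fin d} (hij : i ≠ j) :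
    2 ≤ d ∧ ∃ t' : Fin d → S, (∀ l : Fin d, (l : ℕ) = 0 → t' l = t i) ∧ (∀ l : Fin d, (l : ℕ) = 1 → t' l = t j) ∧
      Set.range t' = Set.range t := by
  have hi2 := i.isLt
  have hj2 := j.isLt
  have hne : (i : ℕ) ≠ j := fun h => hij (Fin.ext h)
  have h2 : 2 ≤ d := by omega
  refine ⟨h2, ?_⟩
  obtain ⟨z0, hz0⟩ : ∃ z : Fin d, (z : ℕ) = 0 := ⟨⟨0, by omega⟩, rfl⟩
  obtain ⟨z1, hz1⟩ : ∃ z : Fin d, (z : ℕ) = 1 := ⟨⟨1, by omega⟩, rfl⟩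
  have h01 : z0 ≠ z1 := fun h => by have := congrArg Fin.val h; omega
  let s : Equiv.Perm (Fin d) := Equiv.swap z0 i
  have hs0 : s z0 = i := Equiv.swap_apply_left _ _
  have hssj : s (s j) = j := Equiv.swap_apply_self _ _ _
  have hsj0 : z0 ≠ s j := by
    intro h
    have e : s z0 = s (s j) := by rw [← h]
    rw [hssj, hs0] at e
    exact hij e
  let σ : Equiv.Perm (Fin d) := (Equiv.swap z1 (s j)).trans s
  refine ⟨t ∘ σ, ?_, ?_, ?_⟩
  · intro l hl
    have hl0 : l = z0 := Fin.ext (by omega)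
    rw [hl0]
    change t (s (Equiv.swap z1 (s j) z0)) = t i
    rw [Equiv.swap_apply_of_ne_of_ne h01 hsj0, hs0]
  · intro l hl
    have hl1 : l = z1 := Fin.ext (by omega)
    rw [hl1]
    change t (s (Equiv.swap z1 (s j) z1)) = t j
    rw [Equiv.swap_apply_left, hssj]
  · exact σ.surjective.range_comp t

/-- **r.s.p. completion of an independent pair**, ordered form: `t 0 = π`, `t 1 = F`, and `2 ≤ d` follows. [folklore] -/
theorem rsop_completion [CommRing S] [IsRegularLocalRing S] {d : ℕ} (hdim : ringKrullDim S = (d : WithBot ℕ∞))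
    (π F : S) (hπ : π ∈ maximalIdeal S) (hπ2 : π ∉ maximalIdeal S ^ 2) (hF : F ∈ maximalIdeal S)
    (hind : ∀ a b : S, a * π + b * F ∈ maximalIdeal S ^ 2 → b ∈ maximalIdeal S) :
    2 ≤ d ∧ ∃ t : Fin d → S, (∀ l : Fin d, (l : ℕ) = 0 → t l = π) ∧ (∀ l : Fin d, (l : ℕ) = 1 → t l = F) ∧
      Ideal.span (Set.range t) = maximalIdeal S := by
  obtain ⟨t, i, j, hij, hti, htj, ht⟩ := exists_rsop_extending_pair hdim π F hπ hπ2 hF hind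
  obtain ⟨h2, t', h0, h1, hr⟩ := exists_reindex_pair t hij
  refine ⟨h2, t', fun l hl => (h0 l hl).trans hti, fun l hl => (h1 l hl).trans htj, ?_⟩
  rw [← ht, hr]


end RSP

variable {K : Type} [Field K]

/-! ## The core, dimension-free (copy of `…Lens5ArcPotentialCore.lean` §Core with `reg`/`dim` removed from the package) -/

section Core

variable {O : ValuationSubring K} {p : ℕ}

namespace CoreHypD

variable {R : ℕ → Subring K} [hRloc : ∀ i, IsLocalRing (R i)] {π : K} {D : Derivation ℤ K K} {s h u : K} {e₀ : ℕ}
  (H : SubringDominates (R 0) O.toSubring ∧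
      (∀ i, IsQuadraticTransformAlong O (R i) (R (i + 1))) ∧ π ∈ R 0 ∧ π ≠ 0 ∧ O.valuation π < 1 ∧
      (∀ x : K, O.valuation x < 1 → O.valuation x ≤ O.valuation π) ∧
      (∀ x : K, x ≠ 0 → ∃ n : ℕ, O.valuation π ^ n ≤ O.valuation x) ∧ (∀ y ∈ R 0, s * D y ∈ R 0) ∧ h ∈ R 0 ∧
      (∀ c : K, c ^ p ≠ h) ∧ (∀ c : K, ∃ c' : K, O.valuation (h - c' ^ p) < O.valuation (h - c ^ p)) ∧ u ∈ R 0 ∧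
      O.valuation u = 1 ∧ s * D h = π ^ e₀ * u)
include H

omit hRloc in
/-- Component `dom0` of the dimension-free THEOREM P hypothesis package (res-B-lens-5 g7/g20). [folklore] -/
theorem dom0 : SubringDominates (R 0) O.toSubring := H.1

omit hRloc in
/-- Component `step` of the dimension-free THEOREM P hypothesis package (res-B-lens-5 g7/g20). [folklore] -/
theorem step : ∀ i, IsQuadraticTransformAlong O (R i) (R (i + 1)) := H.2.1

omit hRloc in
/-- Component `πR` of the dimension-free THEOREM P hypothesis package (res-B-lens-5 g7/g20). [folklore] -/
theorem πR : π ∈ R 0 := H.2.2.1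

omit hRloc in
/-- Component `π0` of the dimension-free THEOREM P hypothesis package (res-B-lens-5 g7/g20). [folklore] -/
theorem π0 : π ≠ 0 := H.2.2.2.1

omit hRloc in
/-- Component `vπ` of the dimension-free THEOREM P hypothesis package (res-B-lens-5 g7/g20). [folklore] -/
theorem vπ : O.valuation π < 1 := H.2.2.2.2.1

omit hRloc in
/-- Component `πmax` of the dimension-free THEOREM P hypothesis package (res-B-lens-5 g7/g20). [folklore] -/
theorem πmax : ∀ x : K, O.valuation x < 1 → O.valuation x ≤ O.valuation π := H.2.2.2.2.2.1

omit hRloc in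
/-- Component `arch` of the dimension-free THEOREM P hypothesis package (res-B-lens-5 g7/g20). [folklore] -/
theorem arch : ∀ x : K, x ≠ 0 → ∃ n : ℕ, O.valuation π ^ n ≤ O.valuation x := H.2.2.2.2.2.2.1

omit hRloc in
/-- Component `der` of the dimension-free THEOREM P hypothesis package (res-B-lens-5 g7/g20). [folklore] -/
theorem der : ∀ y ∈ R 0, s * D y ∈ R 0 := H.2.2.2.2.2.2.2.1

omit hRloc in
/-- Component `hR` of the dimension-free THEOREM P hypothesis package (res-B-lens-5 g7/g20). [folklore] -/
theorem hR : h ∈ R 0 := H.2.2.2.2.2.2.2.2.1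

omit hRloc in
/-- Component `np` of the dimension-free THEOREM P hypothesis package (res-B-lens-5 g7/g20). [folklore] -/
theorem np : ∀ c : K, c ^ p ≠ h := H.2.2.2.2.2.2.2.2.2.1

omit hRloc in
/-- Component `defect` of the dimension-free THEOREM P hypothesis package (res-B-lens-5 g7/g20). [folklore] -/
theorem defect : ∀ c : K, ∃ c' : K, O.valuation (h - c' ^ p) < O.valuation (h - c ^ p) := H.2.2.2.2.2.2.2.2.2.2.1

omit hRloc in
/-- Component `uR` of the dimension-free THEOREM P hypothesis package (res-B-lens-5 g7/g20). [folklore] -/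
theorem uR : u ∈ R 0 := H.2.2.2.2.2.2.2.2.2.2.2.1

omit hRloc in
/-- Component `vu` of the dimension-free THEOREM P hypothesis package (res-B-lens-5 g7/g20). [folklore] -/
theorem vu : O.valuation u = 1 := H.2.2.2.2.2.2.2.2.2.2.2.2.1

omit hRloc in
/-- Component `Dh` of the dimension-free THEOREM P hypothesis package (res-B-lens-5 g7/g20). [folklore] -/
theorem Dh : s * D h = π ^ e₀ * u := H.2.2.2.2.2.2.2.2.2.2.2.2.2


omit hRloc in
/-- `dom` (THEOREM P core, dimension-free copy, res-B-lens-5 g7/g20; see the module docstring). [folklore] -/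
theorem dom (i : ℕ) : SubringDominates (R i) O.toSubring := (sequence_dominates (CoreHypD.dom0 H) (CoreHypD.step H) i).1

omit hRloc in
/-- `mono` (THEOREM P core, dimension-free copy, res-B-lens-5 g7/g20; see the module docstring). [folklore] -/
theorem mono {i j : ℕ} (hij : i ≤ j) : R i ≤ R j := sequence_monotone (CoreHypD.step H) hij

omit hRloc in
/-- `le_O` (THEOREM P core, dimension-free copy, res-B-lens-5 g7/g20; see the module docstring). [folklore] -/
theorem le_O (i : ℕ) : R i ≤ O.toSubring := ((CoreHypD.dom H) i).1

/-- `mem_max` (THEOREM P core, dimension-free copy, res-B-lens-5 g7/g20; see the module docstring). [folklore] -/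
theorem mem_max (i : ℕ) (a : R i) : a ∈ maximalIdeal (R i) ↔ O.valuation (a : K) < 1 :=
  (subringDominates_valuationSubring_iff ((CoreHypD.dom H) i).1).mp ((CoreHypD.dom H) i) a

omit hRloc in
/-- `πRi` (THEOREM P core, dimension-free copy, res-B-lens-5 g7/g20; see the module docstring). [folklore] -/
theorem πRi (i : ℕ) : π ∈ R i := (CoreHypD.mono H) (Nat.zero_le i) (CoreHypD.πR H)

/-- `πmem` (THEOREM P core, dimension-free copy, res-B-lens-5 g7/g20; see the module docstring). [folklore] -/
theorem πmem (i : ℕ) : (⟨π, (CoreHypD.πRi H) i⟩ : R i) ∈ maximalIdeal (R i) := ((CoreHypD.mem_max H) i _).mpr (CoreHypD.vπ H)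

/-- `πnot2` (THEOREM P core, dimension-free copy, res-B-lens-5 g7/g20; see the module docstring). [folklore] -/
theorem πnot2 (i : ℕ) : (⟨π, (CoreHypD.πRi H) i⟩ : R i) ∉ maximalIdeal (R i) ^ 2 := by
  intro h2
  have hle := valuation_le_sq_of_mem_sq' ((CoreHypD.dom H) i) (CoreHypD.πmax H) _ h2
  change O.valuation π ≤ O.valuation π ^ 2 at hle
  have hvπpos : 0 < O.valuation π := zero_lt_iff.mpr ((Valuation.ne_zero_iff _).mpr (CoreHypD.π0 H))
  rw [pow_two] at hle
  have : O.valuation π * 1 ≤ O.valuation π * O.valuation π := by rwa [mul_one]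
  exact absurd (le_of_mul_le_mul_left this hvπpos) (not_le.mpr (CoreHypD.vπ H))

omit hRloc in
/-- `vπpos` (THEOREM P core, dimension-free copy, res-B-lens-5 g7/g20; see the module docstring). [folklore] -/
theorem vπpos : 0 < O.valuation π := zero_lt_iff.mpr ((Valuation.ne_zero_iff _).mpr (CoreHypD.π0 H))

omit hRloc in
/-- `pow_strictAnti` (THEOREM P core, dimension-free copy, res-B-lens-5 g7/g20; see the module docstring). [folklore] -/
theorem pow_strictAnti : StrictAnti (fun n : ℕ => O.valuation π ^ n) := pow_right_strictAnti₀ (CoreHypD.vπpos H) (CoreHypD.vπ H)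

omit hRloc in
/-- `pow_le_pow_iff` (THEOREM P core, dimension-free copy, res-B-lens-5 g7/g20; see the module docstring). [folklore] -/
theorem pow_le_pow_iff {a b : ℕ} : O.valuation π ^ a ≤ O.valuation π ^ b ↔ b ≤ a :=
  StrictAnti.le_iff_ge (CoreHypD.pow_strictAnti H)

omit hRloc in
/-- `pow_lt_pow_iff` (THEOREM P core, dimension-free copy, res-B-lens-5 g7/g20; see the module docstring). [folklore] -/
theorem pow_lt_pow_iff {a b : ℕ} : O.valuation π ^ a < O.valuation π ^ b ↔ b < a :=
  StrictAnti.lt_iff_gt (CoreHypD.pow_strictAnti H)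

omit hRloc in
/-- `pow_inj` (THEOREM P core, dimension-free copy, res-B-lens-5 g7/g20; see the module docstring). [folklore] -/
theorem pow_inj {a b : ℕ} (hab : O.valuation π ^ a = O.valuation π ^ b) : a = b :=
  StrictAnti.injective (CoreHypD.pow_strictAnti H) hab

omit hRloc in
/-- `uRi` (THEOREM P core, dimension-free copy, res-B-lens-5 g7/g20; see the module docstring). [folklore] -/
theorem uRi (i : ℕ) : u ∈ R i := (CoreHypD.mono H) (Nat.zero_le i) (CoreHypD.uR H)

omit hRloc in
/-- `u_unit` (THEOREM P core, dimension-free copy, res-B-lens-5 g7/g20; see the module docstring). [folklore] -/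
theorem u_unit (i : ℕ) : IsUnit (⟨u, (CoreHypD.uRi H) i⟩ : R i) := isUnit_of_valuation_eq_one R (CoreHypD.dom0 H) (CoreHypD.step H) i u ((CoreHypD.uRi H) i) (CoreHypD.vu H)

/-- Stage transport of the derivation: `π^N s • D` preserves `R N`. [folklore] -/
theorem derN : ∀ N, ∀ y ∈ R N, π ^ N * s * D y ∈ R N :=
  derivation_transport_pow R (CoreHypD.dom0 H) (CoreHypD.step H) π (CoreHypD.πR H) (CoreHypD.π0 H) (CoreHypD.vπ H) (CoreHypD.πmax H) D s (CoreHypD.der H)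

omit hRloc in
/-- `derNπ` (THEOREM P core, dimension-free copy, res-B-lens-5 g7/g20; see the module docstring). [folklore] -/
theorem derNπ {N : ℕ} (hN : 1 ≤ N) : ∃ ε ∈ R N, π ^ N * s * D π = π * ε := by
  obtain ⟨M, rfl⟩ := Nat.exists_eq_add_of_le hN
  refine ⟨π ^ M * (s * D π), (R (1 + M)).mul_mem ((R (1 + M)).pow_mem ((CoreHypD.πRi H) _) M) ((CoreHypD.mono H) (Nat.zero_le _) ((CoreHypD.der H) π (CoreHypD.πR H))), ?_⟩
  ring

omit hRloc in
/-- `derNh` (THEOREM P core, dimension-free copy, res-B-lens-5 g7/g20; see the module docstring). [folklore] -/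
theorem derNh (N : ℕ) : π ^ N * s * D h = π ^ (e₀ + N) * u := by
  rw [mul_assoc, (CoreHypD.Dh H)]; ring

omit hRloc H in
/-- `derivation_pow_p` (THEOREM P core, dimension-free copy, res-B-lens-5 g7/g20; see the module docstring). [folklore] -/
theorem derivation_pow_p [CharP K p] (D : Derivation ℤ K K) (c : K) : D (c ^ p) = 0 := by
  rw [Derivation.leibniz_pow, nsmul_eq_mul, CharP.cast_eq_zero K p, zero_mul]

variable [hp : Fact p.Prime] [CharP K p]

omit hp hRloc [CharP K p] in
/-- `f_ne` (THEOREM P core, dimension-free copy, res-B-lens-5 g7/g20; see the module docstring). [folklore] -/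
theorem f_ne (c : K) : h - c ^ p ≠ 0 := sub_ne_zero.mpr (Ne.symm ((CoreHypD.np H) c))

omit hp hRloc [CharP K p] in
/-- `hO` (THEOREM P core, dimension-free copy, res-B-lens-5 g7/g20; see the module docstring). [folklore] -/
theorem hO : h ∈ O := (CoreHypD.le_O H) 0 (CoreHypD.hR H)

omit hp in
/-- (P1) at stage `N ≥ 1`: `(h − c^p)/π^a ∈ R N ⇒ a ≤ e₀ + N`. [folklore] -/
theorem P1 {N : ℕ} (hN : 1 ≤ N) {c : K} {a : ℕ} (hF : (h - c ^ p) / π ^ a ∈ R N) : a ≤ e₀ + N := by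
  let E : Derivation ℤ K K := (π ^ N * s) • D
  have hE : ∀ y, E y = π ^ N * s * D y := fun y => by simp [E, smul_eq_mul]
  have hEN : ∀ y ∈ R N, E y ∈ R N := fun y hy => by rw [hE]; exact (CoreHypD.derN H) N y hy
  have hEπ : ∃ ε ∈ R N, E π = π * ε := by
    obtain ⟨ε, hε, h1⟩ := (CoreHypD.derNπ H) hN
    exact ⟨ε, hε, by rw [hE, h1]⟩
  refine jacobian_bound_of_isUnit E hEN ((CoreHypD.πRi H) N) (CoreHypD.π0 H) ((CoreHypD.πmem H) N) hEπ hF ((CoreHypD.uRi H) N) ((CoreHypD.u_unit H) N) (a := a) (e := e₀ + N) ?_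
  have e1 : π ^ a * ((h - c ^ p) / π ^ a) = h - c ^ p := mul_div_cancel₀ _ (pow_ne_zero a (CoreHypD.π0 H))
  rw [e1, map_sub, derivation_pow_p, sub_zero, hE, (CoreHypD.derNh H)]

omit hp hRloc [CharP K p] in
/-- `v(h − c^p) = v(π)^m` and `(h − c^p)/π^a ∈ R N` give `a ≤ m` and `v((h − c^p)/π^a) = v(π)^(m−a)`. -/
theorem exists_delta {N : ℕ} {c : K} {a m : ℕ} (hF : (h - c ^ p) / π ^ a ∈ R N)
    (hm : O.valuation (h - c ^ p) = O.valuation π ^ m) :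
    ∃ δ : ℕ, m = a + δ ∧ O.valuation ((h - c ^ p) / π ^ a) = O.valuation π ^ δ := by
  have hvπa : O.valuation π ^ a ≠ 0 := pow_ne_zero a (CoreHypD.vπpos H).ne'
  have hvF : O.valuation ((h - c ^ p) / π ^ a) = O.valuation π ^ m / O.valuation π ^ a := by
    rw [map_div₀, map_pow, hm]
  have hle1 : O.valuation ((h - c ^ p) / π ^ a) ≤ 1 := (O.valuation_le_one_iff _).mpr ((CoreHypD.le_O H) N hF)
  have ham : a ≤ m := by
    rw [hvF, div_le_one₀ (zero_lt_iff.mpr hvπa)] at hle1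
    exact (CoreHypD.pow_le_pow_iff H).mp hle1
  obtain ⟨δ, rfl⟩ := Nat.exists_eq_add_of_le ham
  refine ⟨δ, rfl, ?_⟩
  rw [hvF, pow_add, mul_div_cancel_left₀ _ hvπa]

omit hp hRloc [CharP K p] in
/-- `exists_ord` (THEOREM P core, dimension-free copy, res-B-lens-5 g7/g20; see the module docstring). [folklore] -/
theorem exists_ord (c : K) (hc : c ∈ O) : ∃ m : ℕ, O.valuation (h - c ^ p) = O.valuation π ^ m :=
  exists_valuation_eq_pow_of_discrete O π (CoreHypD.πmax H) (CoreHypD.arch H) (h - c ^ p) ((CoreHypD.f_ne H) c) (O.sub_mem (CoreHypD.hO H) (O.pow_mem hc p))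

omit hRloc in
/-- `p_dvd_ord` (THEOREM P core, dimension-free copy, res-B-lens-5 g7/g20; see the module docstring). [folklore] -/
theorem p_dvd_ord {c : K} (hc : c ∈ O) {m : ℕ} (hm : O.valuation (h - c ^ p) = O.valuation π ^ m) : p ∣ m := by
  obtain ⟨j, hj⟩ := valuation_sub_pow_eq_pow_mul O π (CoreHypD.π0 H) (CoreHypD.vπ H) (CoreHypD.πmax H) (CoreHypD.arch H) h (CoreHypD.hO H) (CoreHypD.np H) (CoreHypD.defect H) c hc
  rw [hm] at hj
  exact ⟨j, (CoreHypD.pow_inj H) hj⟩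

omit hRloc H hp in
/-- `bonus_le` (THEOREM P core, dimension-free copy, res-B-lens-5 g7/g20; see the module docstring). [folklore] -/
theorem bonus_le (δ : ℕ) : (if δ = 0 then 1 else if δ = 1 then 2 else 0 : ℕ) ≤ 2 := by
  split_ifs <;> omega

/-- **The potential induction** (P3)–(P5), dimension-free copy: from any state `(N, c, a)` with `(h − c^p)/π^a ∈ R N` the algorithm reaches an exit. [folklore] -/
theorem core_aux : ∀ (μ : ℕ) (N a m : ℕ) (c : K), c ∈ R N → (h - c ^ p) / π ^ a ∈ R N →
    O.valuation (h - c ^ p) = O.valuation π ^ m → 3 * (e₀ + N - a) + (if m - a = 0 then 1 else if m - a = 1 then 2 else 0 : ℕ) ≤ μ →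
    ∃ (n : ℕ) (c' : K), (∃ (m' : ℕ) (G : R n), G ∈ maximalIdeal (R n) ∧ G ∉ maximalIdeal (R n) ^ 2 ∧ (G : K) = (h - c' ^ p) / π ^ (p * m')) ∨
      (∃ (m' : ℕ) (U : R n), IsUnit U ∧ (U : K) = (h - c' ^ p) / π ^ (p * m') ∧
        ∀ c'' : R n, U - c'' ^ p ∉ maximalIdeal (R n)) ∨
      (∃ (m' r : ℕ) (hπn : π ∈ R n) (F : R n), 0 < r ∧ r < p ∧
        (⟨π, hπn⟩ : R n) ∈ maximalIdeal (R n) ∧ (⟨π, hπn⟩ : R n) ∉ maximalIdeal (R n) ^ 2 ∧ F ∈ maximalIdeal (R n) ∧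
        (∀ a' b' : R n, a' * ⟨π, hπn⟩ + b' * F ∈ maximalIdeal (R n) ^ 2 → b' ∈ maximalIdeal (R n)) ∧
        (h - c' ^ p) / π ^ (p * m') = π ^ r * (F : K)) := by
  intro μ
  induction μ using Nat.strong_induction_on with
  | _ μ ih =>
  intro N a m c hcR hF hm hμ
  classical
  obtain ⟨δ, rfl, hvF⟩ := (CoreHypD.exists_delta H) hF hm
  rw [Nat.add_sub_cancel_left] at hμ
  set f : K := h - c ^ p with hfdef
  set F : K := f / π ^ a with hFdef
  have hfF : f = π ^ a * F := by rw [hFdef, mul_div_cancel₀ _ (pow_ne_zero a (CoreHypD.π0 H))]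
  have hcO : c ∈ O := (CoreHypD.le_O H) N hcR
  let Fr : R N := ⟨F, hF⟩
  rcases Nat.lt_or_ge δ 1 with hδ | hδ
  · -- δ = 0 : unit case (P3)
    have hδ0 : δ = 0 := by omega
    subst hδ0
    rw [pow_zero] at hvF
    have hunit : IsUnit Fr := isUnit_of_valuation_eq_one R (CoreHypD.dom0 H) (CoreHypD.step H) N F hF hvF
    obtain ⟨j, hj⟩ := (CoreHypD.p_dvd_ord H) hcO hm
    rw [Nat.add_zero] at hj
    by_cases hβ : ∃ β : R N, Fr - β ^ p ∈ maximalIdeal (R N)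
    · -- update `c ↦ c + π^j β`
      obtain ⟨β, hβ⟩ := hβ
      set c' : K := c + π ^ j * (β : K) with hc'def
      have hc'R : c' ∈ R N := (R N).add_mem hcR ((R N).mul_mem ((R N).pow_mem ((CoreHypD.πRi H) N) j) β.2)
      have hf' : h - c' ^ p = π ^ a * (F - (β : K) ^ p) := by
        rw [hc'def, add_pow_char, mul_pow, ← pow_mul, mul_comm j p, ← hj, mul_sub, ← hfF, hfdef]; ring
      have hF' : (h - c' ^ p) / π ^ a ∈ R N := by
        rw [hf', mul_div_cancel_left₀ _ (pow_ne_zero a (CoreHypD.π0 H))]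
        exact (R N).sub_mem hF ((R N).pow_mem β.2 p)
      obtain ⟨m', hm'⟩ := (CoreHypD.exists_ord H) c' ((CoreHypD.le_O H) N hc'R)
      obtain ⟨δ', hδ'eq, hvF'⟩ := (CoreHypD.exists_delta H) hF' hm'
      -- `δ' ≥ 2`
      have hvlt : O.valuation ((h - c' ^ p) / π ^ a) < 1 := by
        rw [hf', mul_div_cancel_left₀ _ (pow_ne_zero a (CoreHypD.π0 H))]
        exact ((CoreHypD.mem_max H) N (Fr - β ^ p)).mp hβ
      have hδ'pos : 0 < δ' := by
        rw [hvF'] at hvlt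
        by_contra h0
        have : δ' = 0 := by omega
        rw [this, pow_zero] at hvlt
        exact lt_irrefl _ hvlt
      have hpd : p ∣ m' := (CoreHypD.p_dvd_ord H) ((CoreHypD.le_O H) N hc'R) hm'
      have hδ'2 : 2 ≤ δ' := by
        have hp2 : 2 ≤ p := hp.out.two_le
        obtain ⟨j', hj'⟩ := hpd
        have : p * j < p * j' := by rw [← hj, ← hj', hδ'eq]; omega
        have hjj : j + 1 ≤ j' := Nat.lt_of_mul_lt_mul_left this
        have : a + δ' = p * j' := by rw [← hδ'eq, hj']
        nlinarith
      refine ih _ ?_ N a m' c' hc'R hF' hm' le_rfl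
      rw [hδ'eq, Nat.add_sub_cancel_left]
      have hb : (if δ' = 0 then 1 else if δ' = 1 then 2 else 0 : ℕ) = 0 := by rw [if_neg (by omega), if_neg (by omega)]
      have hb0 : (if 0 = 0 then 1 else if 0 = 1 then 2 else 0 : ℕ) = 1 := by rw [if_pos rfl]
      rw [hb0] at hμ; rw [hb]; omega
    · -- EXIT, loose clean form (2)
      push Not at hβ
      refine ⟨N, c, Or.inr (Or.inl ⟨j, Fr, hunit, ?_, hβ⟩)⟩
      change F = (h - c ^ p) / π ^ (p * j)
      rw [← hj]
  rcases Nat.lt_or_ge δ 2 with hδ2 | hδ2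
  · -- δ = 1 : blow up (shape L2)
    have hδ1 : δ = 1 := by omega
    subst hδ1
    rw [pow_one] at hvF
    have hvF1 : O.valuation F < 1 := by rw [hvF]; exact (CoreHypD.vπ H)
    have hF' : F / π ∈ R (N + 1) := div_mem_succ_of_lt R (CoreHypD.dom0 H) (CoreHypD.step H) π (CoreHypD.πR H) (CoreHypD.π0 H) (CoreHypD.vπ H) (CoreHypD.πmax H) N F hF hvF1
    have hF'' : (h - c ^ p) / π ^ (a + 1) ∈ R (N + 1) := by
      have e : (h - c ^ p) / π ^ (a + 1) = F / π := by rw [hFdef, hfdef, pow_succ, div_div]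
      rw [e]; exact hF'
    refine ih _ ?_ (N + 1) (a + 1) (a + 1) c ((CoreHypD.mono H) (Nat.le_succ N) hcR) hF'' hm le_rfl
    have e1 : e₀ + (N + 1) - (a + 1) = e₀ + N - a := by omega
    rw [e1, Nat.sub_self]
    have hb0 : (if 0 = 0 then 1 else if 0 = 1 then 2 else 0 : ℕ) = 1 := by rw [if_pos rfl]
    have hb1 : (if 1 = 0 then 1 else if 1 = 1 then 2 else 0 : ℕ) = 2 := by rw [if_neg one_ne_zero, if_pos rfl]
    rw [hb1] at hμ; rw [hb0]; omega
  -- δ ≥ 2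
  have hvF1 : O.valuation F < 1 := by
    rw [hvF]; exact pow_lt_one₀ zero_le (CoreHypD.vπ H) (by omega)
  have hFm : Fr ∈ maximalIdeal (R N) := ((CoreHypD.mem_max H) N Fr).mpr hvF1
  have hbδ : (if δ = 0 then 1 else if δ = 1 then 2 else 0 : ℕ) = 0 := by rw [if_neg (by omega), if_neg (by omega)]
  rw [hbδ, Nat.add_zero] at hμ
  by_cases hF2 : Fr ∈ maximalIdeal (R N) ^ 2
  · -- blow up (shape L1): `a` rises by `2`
    have hF' : F / π ^ 2 ∈ R (N + 1) := div_pow_mem_succ_of_mem_pow R (CoreHypD.dom0 H) (CoreHypD.step H) π (CoreHypD.πR H) (CoreHypD.π0 H) (CoreHypD.vπ H) (CoreHypD.πmax H) N 2 Fr hF2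
    have hF'' : (h - c ^ p) / π ^ (a + 2) ∈ R (N + 1) := by
      have e : (h - c ^ p) / π ^ (a + 2) = F / π ^ 2 := by rw [hFdef, hfdef, pow_add, div_div]
      rw [e]; exact hF'
    have hP1 := (CoreHypD.P1 H) (Nat.le_add_left 1 N) hF''
    refine ih _ ?_ (N + 1) (a + 2) (a + δ) c ((CoreHypD.mono H) (Nat.le_succ N) hcR) hF'' hm le_rfl
    have hb := bonus_le (a + δ - (a + 2))
    omega
  · -- EXIT by the valuative detector (P2)
    have hvF2 : O.valuation (Fr : K) ≤ O.valuation π ^ 2 := by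
      change O.valuation F ≤ _; rw [hvF]; exact (CoreHypD.pow_le_pow_iff H).mpr hδ2
    have hind : ∀ a' b' : R N, a' * ⟨π, (CoreHypD.πRi H) N⟩ + b' * Fr ∈ maximalIdeal (R N) ^ 2 → b' ∈ maximalIdeal (R N) :=
      fun a' b' hab => (indep_of_valuation ((CoreHypD.dom H) N) ((CoreHypD.πRi H) N) (CoreHypD.π0 H) ((CoreHypD.πmem H) N) (CoreHypD.πmax H) Fr hFm hF2 hvF2 a' b' hab).2
    by_cases hpa : p ∣ a
    · -- loose clean form (3)
      obtain ⟨m', hm'⟩ := hpa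
      refine ⟨N, c, Or.inl ⟨m', Fr, hFm, hF2, ?_⟩⟩
      change F = (h - c ^ p) / π ^ (p * m')
      rw [← hm']
    · -- loose clean form (1) with exponents `(r, 1)`: the pair `(π, F)` is handed over UNCOMPLETED (dimension-free)
      refine ⟨N, c, Or.inr (Or.inr ⟨a / p, a % p, (CoreHypD.πRi H) N, Fr, Nat.pos_of_ne_zero fun h0 => hpa
        (Nat.dvd_of_mod_eq_zero h0), Nat.mod_lt a hp.out.pos, (CoreHypD.πmem H) N, (CoreHypD.πnot2 H) N, hFm, hind, ?_⟩)⟩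
      change (h - c ^ p) / π ^ (p * (a / p)) = π ^ (a % p) * F
      have hdm : a = p * (a / p) + a % p := (Nat.div_add_mod a p).symm
      rw [← hfdef, hfF]
      nth_rw 1 [hdm]
      rw [pow_add, mul_assoc, mul_div_cancel_left₀ _ (pow_ne_zero _ (CoreHypD.π0 H))]

/-- **THEOREM P, core form, dimension-free** (exit (1) returns the independent pair `(π, F)`; no `dim`, no `reg`). [folklore] -/
theorem core : ∃ (n : ℕ) (c : K),
    (∃ (m' : ℕ) (G : R n), G ∈ maximalIdeal (R n) ∧ G ∉ maximalIdeal (R n) ^ 2 ∧ (G : K) = (h - c ^ p) / π ^ (p * m')) ∨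
      (∃ (m' : ℕ) (U : R n), IsUnit U ∧ (U : K) = (h - c ^ p) / π ^ (p * m') ∧
        ∀ c'' : R n, U - c'' ^ p ∉ maximalIdeal (R n)) ∨
      (∃ (m' r : ℕ) (hπn : π ∈ R n) (F : R n), 0 < r ∧ r < p ∧
        (⟨π, hπn⟩ : R n) ∈ maximalIdeal (R n) ∧ (⟨π, hπn⟩ : R n) ∉ maximalIdeal (R n) ^ 2 ∧ F ∈ maximalIdeal (R n) ∧
        (∀ a' b' : R n, a' * ⟨π, hπn⟩ + b' * F ∈ maximalIdeal (R n) ^ 2 → b' ∈ maximalIdeal (R n)) ∧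
        (h - c ^ p) / π ^ (p * m') = π ^ r * (F : K)) := by
  obtain ⟨m, hm⟩ := (CoreHypD.exists_ord H) 0 O.zero_mem
  refine (CoreHypD.core_aux H) _ 0 0 m 0 (R 0).zero_mem ?_ hm le_rfl
  rw [pow_zero, div_one, zero_pow hp.out.ne_zero, sub_zero]
  exact (CoreHypD.hR H)

end CoreHypD

end Core

/-! ## Exit (1) ⇒ conclusion in dimension `d` -/

section Conclusion

variable {k : Type} [Field k] [Algebra k K]

/-- Exit (1) ⇒ conclusion, dimension `d`: the monomial `π^r F`, the independent pair `(π, F)` completed to a regular system of parameters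
`t : Fin d → Rn` (`t 0 = π`, `t 1 = F`) by `rsop_completion`; `0 < r < p`. [folklore] -/
theorem concl_of_exit1_d {p : ℕ} [hp : Fact p.Prime] [CharP K p] {O : ValuationSubring K} {A A' : Subalgebra k K}
    (hA'O : A'.toSubring ≤ O.toSubring) (hAA' : A ≤ A') (hA'fg : A'.FG)
    (Rn : Subring K) [IsLocalRing Rn] (hreg : IsRegularLocalRing Rn) (hRn : Rn = locAtCentre A'.toSubring O)
    {d : ℕ} (hdimRn : ringKrullDim Rn = (d : WithBot ℕ∞))
    (g₀ b c π : K) (hb : b ≠ 0) (hπ0 : π ≠ 0) (m' r : ℕ) (hr0 : 0 < r) (hrp : r < p)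
    (hπn : π ∈ Rn) (F : Rn) (hπm : (⟨π, hπn⟩ : Rn) ∈ maximalIdeal Rn) (hπm2 : (⟨π, hπn⟩ : Rn) ∉ maximalIdeal Rn ^ 2)
    (hFm : F ∈ maximalIdeal Rn) (hind : ∀ a' b' : Rn, a' * ⟨π, hπn⟩ + b' * F ∈ maximalIdeal Rn ^ 2 → b' ∈ maximalIdeal Rn)
    (heq : (b ^ p * g₀ - c ^ p) / π ^ (p * m') = π ^ r * (F : K)) :
    (∃ (A' : Subalgebra k K), A'.toSubring ≤ O.toSubring ∧ A ≤ A' ∧ A'.FG ∧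
      ∃ (_ : IsRegularLocalRing (locAtCentre A'.toSubring O)) (c : Fin p → K), (∃ j : Fin p, (j : ℕ) ≠ 0 ∧ c j ≠ 0) ∧
      ((∃ (d m : ℕ) (hmd : m ≤ d) (t : Fin d → ↥(locAtCentre A'.toSubring O)) (a : Fin m → ℕ) (u : ↥(locAtCentre A'.toSubring O)), IsUnit u ∧
      Ideal.span (Set.range t) = IsLocalRing.maximalIdeal ↥(locAtCentre A'.toSubring O) ∧
      ringKrullDim ↥(locAtCentre A'.toSubring O) = (d : WithBot ℕ∞) ∧ 0 < m ∧ (∀ i, ¬ p ∣ a i) ∧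
      (∑ j : Fin p, c j ^ p * g₀ ^ (j : ℕ)) = (u : K) * ∏ i : Fin m, ((t (Fin.castLE hmd i) : ↥(locAtCentre A'.toSubring O)) : K) ^ (a i)) ∨
      (∃ u : ↥(locAtCentre A'.toSubring O), IsUnit u ∧ (∑ j : Fin p, c j ^ p * g₀ ^ (j : ℕ)) = (u : K) ∧
      ∀ c' : ↥(locAtCentre A'.toSubring O), u - c' ^ p ∉ IsLocalRing.maximalIdeal ↥(locAtCentre A'.toSubring O)) ∨
      (∃ s c' : ↥(locAtCentre A'.toSubring O), (∑ j : Fin p, c j ^ p * g₀ ^ (j : ℕ)) = (s : K) ∧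
      s - c' ^ p ∈ IsLocalRing.maximalIdeal ↥(locAtCentre A'.toSubring O) ∧
      s - c' ^ p ∉ IsLocalRing.maximalIdeal ↥(locAtCentre A'.toSubring O) ^ 2))) := by
  subst hRn
  haveI := hreg
  obtain ⟨h2, t, ht0, ht1, ht⟩ := rsop_completion hdimRn ⟨π, hπn⟩ F hπm hπm2 hFm hind
  refine ⟨A', hA'O, hAA', hA'fg, hreg,
    fun j : Fin p => if (j : ℕ) = 0 then -c / π ^ m' else if (j : ℕ) = 1 then b / π ^ m' else 0, ?_, ?_⟩
  · refine ⟨⟨1, hp.out.one_lt⟩, one_ne_zero, ?_⟩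
    simp only [one_ne_zero, if_false, if_true]
    exact div_ne_zero hb (pow_ne_zero _ hπ0)
  · refine Or.inl ⟨d, 2, h2, t, ![r, 1], 1, isUnit_one, ht, hdimRn, by norm_num, ?_, ?_⟩
    · intro i
      fin_cases i
      · exact Nat.not_dvd_of_pos_of_lt hr0 hrp
      · exact hp.out.not_dvd_one
    · have e0 : t (Fin.castLE h2 0) = ⟨π, hπn⟩ := ht0 _ (by simp)
      have e1 : t (Fin.castLE h2 1) = F := ht1 _ (by simp)
      rw [sum_rep_eq, heq, Fin.prod_univ_two]
      simp only [e0, e1, Matrix.cons_val_zero, Matrix.cons_val_one, pow_one, Subring.coe_one, one_mul]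


end Conclusion

/-! ## THEOREM P_d -/

section Main

variable {k : Type} [Field k] [Algebra k K]

/-- **THEOREM P_d** (THEOREM P of memo e709ae1b8c5f §2 in centre dimension `d`): class (A) — discrete rank-one `O`, `g₀` with no best
`p`-th-power approximation, a derivation moving `g₀` with bounded denominators on `A` — has clean local uniformization in loose clean form,
for EVERY residue tower, EVERY ground field and EVERY dimension `d` (`d = 0` is contradictory, `d = 3` is ✓p691218; `_htd`, `_hdimA` unused). [folklore] -/
theorem arcPotential_d (p : ℕ) (hp : p.Prime) (d : ℕ) (k : Type) [Field k] [CharP k p] (K : Type) [Field K] [Algebra k K]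
    (O : ValuationSubring K) (A : Subalgebra k K) (hAO : A.toSubring ≤ O.toSubring) (hAfg : A.FG)
    (hfrac : IsFractionRing A K) (_hdimA : ringKrullDim A ≤ (d : WithBot ℕ∞)) (hreg : IsRegularLocalRing (locAtCentre A.toSubring O))
    (hdim : ringKrullDim (locAtCentre A.toSubring O) = (d : WithBot ℕ∞))
    (hzd : ∀ (T : Subring K) (hT : T ≤ O.toSubring), A.toSubring ≤ T → (subringCentre T O hT).IsMaximal)
    (g₀ : K) (hg₀ : ∀ c : K, c ^ p ≠ g₀)
    (hdefect : ∀ f₀ : K, ∃ f₁ : K, O.valuation (g₀ - f₁ ^ p) < O.valuation (g₀ - f₀ ^ p))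
    (_htd : ∀ hk : ∀ c : k, algebraMap k K c ∈ O, transcendenceDefect k O hk ≠ 0)
    (hdisc : ∃ π : K, π ≠ 0 ∧ (∀ x : K, O.valuation x < 1 → O.valuation x ≤ O.valuation π) ∧
      (∀ x : K, x ≠ 0 → ∃ n : ℕ, O.valuation π ^ n ≤ O.valuation x))
    (hDer : ∃ (D : Derivation ℤ K K) (s : K), s ≠ 0 ∧ (∀ y : K, y ∈ A → s * D y ∈ A) ∧ D g₀ ≠ 0) :
    (∃ (A' : Subalgebra k K), A'.toSubring ≤ O.toSubring ∧ A ≤ A' ∧ A'.FG ∧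
      ∃ (_ : IsRegularLocalRing (locAtCentre A'.toSubring O)) (c : Fin p → K), (∃ j : Fin p, (j : ℕ) ≠ 0 ∧ c j ≠ 0) ∧
      ((∃ (d m : ℕ) (hmd : m ≤ d) (t : Fin d → ↥(locAtCentre A'.toSubring O)) (a : Fin m → ℕ) (u : ↥(locAtCentre A'.toSubring O)), IsUnit u ∧
      Ideal.span (Set.range t) = IsLocalRing.maximalIdeal ↥(locAtCentre A'.toSubring O) ∧
      ringKrullDim ↥(locAtCentre A'.toSubring O) = (d : WithBot ℕ∞) ∧ 0 < m ∧ (∀ i, ¬ p ∣ a i) ∧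
      (∑ j : Fin p, c j ^ p * g₀ ^ (j : ℕ)) = (u : K) * ∏ i : Fin m, ((t (Fin.castLE hmd i) : ↥(locAtCentre A'.toSubring O)) : K) ^ (a i)) ∨
      (∃ u : ↥(locAtCentre A'.toSubring O), IsUnit u ∧ (∑ j : Fin p, c j ^ p * g₀ ^ (j : ℕ)) = (u : K) ∧
      ∀ c' : ↥(locAtCentre A'.toSubring O), u - c' ^ p ∉ IsLocalRing.maximalIdeal ↥(locAtCentre A'.toSubring O)) ∨
      (∃ s c' : ↥(locAtCentre A'.toSubring O), (∑ j : Fin p, c j ^ p * g₀ ^ (j : ℕ)) = (s : K) ∧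
      s - c' ^ p ∈ IsLocalRing.maximalIdeal ↥(locAtCentre A'.toSubring O) ∧
      s - c' ^ p ∉ IsLocalRing.maximalIdeal ↥(locAtCentre A'.toSubring O) ^ 2))) := by
  obtain ⟨π, hπ0, hπ, harch⟩ := hdisc
  obtain ⟨D, s, hs0, hDA, hDg⟩ := hDer
  classical
  haveI : Fact p.Prime := ⟨hp⟩
  haveI : CharP K p := charP_of_injective_algebraMap (algebraMap k K).injective p
  -- `v π < 1` WITHOUT the sequence: `g₀` has no best `p`-th-power approximation, so `O ≠ K` and `π` is a non-unit of `O`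
  have hg0 : g₀ ≠ 0 := fun h0 => hg₀ 0 (by rw [h0, zero_pow hp.ne_zero])
  have hvπ : O.valuation π < 1 := by
    obtain ⟨f₁, hf₁⟩ := hdefect 0
    rw [zero_pow hp.ne_zero, sub_zero] at hf₁
    have hy0 : g₀ - f₁ ^ p ≠ 0 := sub_ne_zero.mpr (Ne.symm (hg₀ f₁))
    have hvg : O.valuation g₀ ≠ 0 := (Valuation.ne_zero_iff _).mpr hg0
    have hz : O.valuation ((g₀ - f₁ ^ p) / g₀) < 1 := by
      rw [map_div₀, div_lt_one₀ (zero_lt_iff.mpr hvg)]; exact hf₁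
    have hz0 : (g₀ - f₁ ^ p) / g₀ ≠ 0 := div_ne_zero hy0 hg0
    obtain ⟨n, hn⟩ := harch _ hz0
    by_contra hge
    push Not at hge
    have : (1 : O.ValueGroup) ≤ O.valuation π ^ n := one_le_pow₀ hge
    exact absurd (this.trans hn) (not_le.mpr hz)
  have hπO : π ∈ O := by rw [← O.valuation_le_one_iff]; exact hvπ.le
  have hvπpos : 0 < O.valuation π := zero_lt_iff.mpr ((Valuation.ne_zero_iff _).mpr hπ0)
  -- `d ≠ 0`: a regular local ring of dimension `0` is a field, and then `v` would be trivial on `K = Frac A`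
  have hd : ringKrullDim (locAtCentre A.toSubring O) ≠ 0 := by
    intro h0
    haveI := hreg
    have hsf : (maximalIdeal (locAtCentre A.toSubring O)).spanFinrank = 0 := by
      have e := IsRegularLocalRing.spanFinrank_maximalIdeal (R := locAtCentre A.toSubring O)
      rw [h0] at e; exact_mod_cast e
    obtain ⟨x, hx⟩ := exists_regularSystemOfParameters (R := locAtCentre A.toSubring O)
    have hbot : maximalIdeal (locAtCentre A.toSubring O) = ⊥ := by
      rw [← hx, Ideal.span_eq_bot]
      rintro _ ⟨i, rfl⟩
      exact (Fin.cast hsf i).elim0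
    have hLO : SubringDominates (locAtCentre A.toSubring O) O.toSubring := subringDominates_locAtCentre hAO
    have hmemL : ∀ a : locAtCentre A.toSubring O, a ∈ maximalIdeal _ ↔ O.valuation (a : K) < 1 :=
      fun a => (subringDominates_valuationSubring_iff hLO.1).mp hLO a
    have hv1 : ∀ a : K, a ∈ A → a ≠ 0 → O.valuation a = 1 := by
      intro a ha ha0
      have haL : a ∈ locAtCentre A.toSubring O := le_locAtCentre _ O ha
      have hle : O.valuation a ≤ 1 := (O.valuation_le_one_iff _).mpr (hAO ha)
      refine le_antisymm hle (not_lt.mp fun hlt => ha0 ?_)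
      have hm : (⟨a, haL⟩ : locAtCentre A.toSubring O) ∈ maximalIdeal _ := (hmemL ⟨a, haL⟩).mpr hlt
      rw [hbot, Ideal.mem_bot] at hm
      exact congrArg Subtype.val hm
    obtain ⟨a, b, hb, hab⟩ := IsFractionRing.div_surjective (A := A) π
    have hab' : (a : K) / (b : K) = π := hab
    have hb0 : (b : K) ≠ 0 := fun h => nonZeroDivisors.ne_zero hb (Subtype.ext h)
    have ha0 : (a : K) ≠ 0 := by
      intro h; apply hπ0; rw [← hab', h, zero_div]
    have h1 : O.valuation π = 1 := by rw [← hab', map_div₀, hv1 _ a.2 ha0, hv1 _ b.2 hb0, div_one]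
    exact absurd h1 hvπ.ne
  -- (0) the quadratic sequence package
  obtain ⟨R, hR0, hstep, hregR, hdimR, hmodel⟩ := exists_quadraticSeq_package A O hAO hAfg hreg hd hzd
  haveI hRloc : ∀ i, IsLocalRing (R i) := fun i => by haveI := hregR i; infer_instance
  have h0dom : SubringDominates (R 0) O.toSubring := by rw [hR0]; exact subringDominates_locAtCentre hAO
  have hdom : ∀ i, SubringDominates (R i) O.toSubring := fun i => (sequence_dominates h0dom hstep i).1
  have hmono : ∀ {i j : ℕ}, i ≤ j → R i ≤ R j := fun hij => sequence_monotone hstep hij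
  have hof : IsLocalRingOf (R 0) := by rw [hR0]; exact isLocalRingOf_locAtCentre A O hAO
  have hdimRd : ∀ i, ringKrullDim (R i) = (d : WithBot ℕ∞) := fun i => (hdimR i).trans hdim
  have hAR0 : A.toSubring ≤ R 0 := by rw [hR0]; exact le_locAtCentre _ O
  have hmemR : ∀ i (a : R i), a ∈ maximalIdeal (R i) ↔ O.valuation (a : K) < 1 := fun i =>
    (subringDominates_valuationSubring_iff (hdom i).1).mp (hdom i)
  -- (1) `h = b^p g₀ ∈ A`
  obtain ⟨a, b, hb, hab⟩ := IsFractionRing.div_surjective (A := A) g₀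
  have hab' : (a : K) / (b : K) = g₀ := hab
  have hb0 : (b : K) ≠ 0 := fun h => nonZeroDivisors.ne_zero hb (Subtype.ext h)
  set h : K := (b : K) ^ p * g₀ with hhdef
  have hhA : h ∈ A := by
    have : h = (a : K) * (b : K) ^ (p - 1) := by
      obtain ⟨q, hq⟩ : ∃ q, p = q + 1 := ⟨p - 1, (Nat.sub_add_cancel hp.one_lt.le).symm⟩
      rw [hhdef, ← hab', hq, Nat.add_sub_cancel, pow_succ]
      field_simp
    rw [this]
    exact A.mul_mem a.2 (A.pow_mem b.2 _)
  -- (2) transport of the derivation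
  have hD0 : ∀ y ∈ R 0, s * D y ∈ R 0 := by
    rw [hR0]
    exact mul_derivation_mem_locAtCentre D s (B := A.toSubring) (O := O) (fun y hy => hDA y hy)
  have hDer := exists_derivation_preserving_seq R hstep D s hs0 hD0
  -- (3) climb until `π` is absorbed
  obtain ⟨n₁, hπn₁⟩ := exists_mem_of_quadraticTransforms_of_discrete O R hof h0dom hstep π hπ harch π hπO
  -- the restarted sequence at `n₁`
  let R' : ℕ → Subring K := fun i => R (n₁ + i)
  haveI hR'loc : ∀ i, IsLocalRing (R' i) := fun i => hRloc (n₁ + i)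
  have hstep' : ∀ i, IsQuadraticTransformAlong O (R' i) (R' (i + 1)) := fun i => by
    change IsQuadraticTransformAlong O (R (n₁ + i)) (R (n₁ + (i + 1)))
    rw [← add_assoc]; exact hstep (n₁ + i)
  have h0' : SubringDominates (R' 0) O.toSubring := hdom (n₁ + 0)
  have hπR' : π ∈ R' 0 := hπn₁
  -- the derivation at stage `n₁`, `E h = π^o u`
  obtain ⟨s₁, hs₁0, hD₁⟩ := hDer n₁
  have hDh : D h = (b : K) ^ p * D g₀ := by
    rw [hhdef, Derivation.leibniz, Derivation.leibniz_pow]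
    simp [smul_eq_mul, nsmul_eq_mul]
  have hEh0 : s₁ * D h ≠ 0 := mul_ne_zero hs₁0 (by rw [hDh]; exact mul_ne_zero (pow_ne_zero _ hb0) hDg)
  have hhR : h ∈ R n₁ := hmono (Nat.zero_le n₁) (hAR0 hhA)
  have hEhR : s₁ * D h ∈ R' 0 := hD₁ h hhR
  have hEhO : s₁ * D h ∈ O := (hdom n₁).1 hEhR
  obtain ⟨o, ho⟩ := exists_valuation_eq_pow_of_discrete O π hπ harch (s₁ * D h) hEh0 hEhO
  obtain ⟨u, huR, hvu, hEu⟩ := exists_eq_pow_mul_unit R' h0' hstep' π hπR' hπ0 hvπ hπ o 0 (s₁ * D h) hEhR ho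
  rw [Nat.zero_add] at huR
  -- restart again at `n₂ := n₁ + o`
  let R'' : ℕ → Subring K := fun i => R (n₁ + o + i)
  haveI hR''loc : ∀ i, IsLocalRing (R'' i) := fun i => hRloc (n₁ + o + i)
  have hstep'' : ∀ i, IsQuadraticTransformAlong O (R'' i) (R'' (i + 1)) := fun i => by
    change IsQuadraticTransformAlong O (R (n₁ + o + i)) (R (n₁ + o + (i + 1)))
    rw [← add_assoc]; exact hstep (n₁ + o + i)
  have hder'' : ∀ y ∈ R'' 0, π ^ o * s₁ * D y ∈ R'' 0 :=
    derivation_transport_pow R' h0' hstep' π hπR' hπ0 hvπ hπ D s₁ hD₁ o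
  have hnp : ∀ c : K, c ^ p ≠ h := by
    intro c hc
    apply hg₀ (c / (b : K))
    rw [div_pow, hc, hhdef, mul_div_cancel_left₀ _ (pow_ne_zero _ hb0)]
  have hdefect' : ∀ c : K, ∃ c' : K, O.valuation (h - c' ^ p) < O.valuation (h - c ^ p) := by
    intro c
    obtain ⟨f₁, hf₁⟩ := hdefect (c / (b : K))
    refine ⟨(b : K) * f₁, ?_⟩
    have e1 : h - ((b : K) * f₁) ^ p = (b : K) ^ p * (g₀ - f₁ ^ p) := by rw [hhdef]; ring
    have e2 : h - c ^ p = (b : K) ^ p * (g₀ - (c / (b : K)) ^ p) := by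
      rw [hhdef, div_pow, mul_sub, mul_div_cancel₀ _ (pow_ne_zero _ hb0)]
    rw [e1, e2, map_mul, map_mul]
    have hbp : 0 < O.valuation ((b : K) ^ p) :=
      zero_lt_iff.mpr ((Valuation.ne_zero_iff _).mpr (pow_ne_zero _ hb0))
    by_contra hle
    push Not at hle
    exact absurd (le_of_mul_le_mul_left hle hbp) (not_le.mpr hf₁)
  have hDh' : π ^ o * s₁ * D h = π ^ (o + o) * u := by rw [mul_assoc, hEu]; ring
  have H : SubringDominates (R'' 0) O.toSubring ∧
      (∀ i, IsQuadraticTransformAlong O (R'' i) (R'' (i + 1))) ∧ π ∈ R'' 0 ∧ π ≠ 0 ∧ O.valuation π < 1 ∧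
      (∀ x : K, O.valuation x < 1 → O.valuation x ≤ O.valuation π) ∧
      (∀ x : K, x ≠ 0 → ∃ n : ℕ, O.valuation π ^ n ≤ O.valuation x) ∧ (∀ y ∈ R'' 0, π ^ o * s₁ * D y ∈ R'' 0) ∧ h ∈ R'' 0 ∧
      (∀ c : K, c ^ p ≠ h) ∧ (∀ c : K, ∃ c' : K, O.valuation (h - c' ^ p) < O.valuation (h - c ^ p)) ∧ u ∈ R'' 0 ∧
      O.valuation u = 1 ∧ π ^ o * s₁ * D h = π ^ (o + o) * u :=
    ⟨hdom _, hstep'', hmono (Nat.le_add_right n₁ o) hπn₁, hπ0, hvπ, hπ, harch, hder'',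
      hmono (Nat.le_add_right n₁ o) hhR, hnp, hdefect', huR, hvu, hDh'⟩
  -- run the algorithm
  obtain ⟨n, c, hexit⟩ := (CoreHypD.core H)
  obtain ⟨A', hA'O, hAA', hA'fg, hRn⟩ := hmodel (n₁ + o + n)
  have hregn : IsRegularLocalRing (R'' n) := hregR _
  rcases hexit with ⟨m', G, hGm, hGm2, hG⟩ | ⟨m', U, hU, hUeq, hres⟩ | ⟨m', r, hπn, F, hr0, hrp, hπm, hπm2, hFm, hind, heq⟩
  · exact concl_of_exit3 hA'O hAA' hA'fg (R'' n) hregn hRn g₀ (b : K) c π hb0 hπ0 m' G hGm hGm2 (by rw [hG])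
  · exact concl_of_exit2 hA'O hAA' hA'fg (R'' n) hregn hRn g₀ (b : K) c π hb0 hπ0 m' U hU (by rw [hUeq]) hres
  · exact concl_of_exit1_d hA'O hAA' hA'fg (R'' n) hregn hRn (hdimRd _) g₀ (b : K) c π hb0 hπ0 m' r hr0 hrp hπn F hπm hπm2 hFm hind
      (by rw [← heq])


end Main

end Summit.ResolutionOfSingularities.ResolutionOfSingularities.Cruxes.DescentPerfectToAll.Lens5ArcAllDim

/-! ## The registrar's targets (`Census_lens1_g3_DimTransport.lean`, namespace `…Cruxes.DescentPerfectToAll.Census5DimTransport`),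
re-declared token-identically and PROVED -/

namespace Summit.ResolutionOfSingularities.ResolutionOfSingularities.Cruxes.DescentPerfectToAll.Lens5ArcAllDim

/-- THEOREM P at centre dimension `d` — VERBATIM copy of `Census5DimTransport.CleanLUArcAtDim` (res-B-lens-1 g3). [folklore] -/
def CleanLUArcAtDim (p d : ℕ) : Prop :=
    ∀ (k : Type) [Field k] [CharP k p] (K : Type) [Field K] [Algebra k K]
    (O : ValuationSubring K) (A : Subalgebra k K), A.toSubring ≤ O.toSubring → A.FG → IsFractionRing A K →
    ringKrullDim A ≤ (d : WithBot ℕ∞) → IsRegularLocalRing (locAtCentre A.toSubring O) →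
    ringKrullDim (locAtCentre A.toSubring O) = (d : WithBot ℕ∞) →
    (∀ (T : Subring K) (hT : T ≤ O.toSubring), A.toSubring ≤ T → (subringCentre T O hT).IsMaximal) →
    ∀ g₀ : K, (∀ c : K, c ^ p ≠ g₀) →
    (∀ f₀ : K, ∃ f₁ : K, O.valuation (g₀ - f₁ ^ p) < O.valuation (g₀ - f₀ ^ p)) →
    (∀ hk : ∀ c : k, algebraMap k K c ∈ O, transcendenceDefect k O hk ≠ 0) →
    (∃ π : K, π ≠ 0 ∧ (∀ x : K, O.valuation x < 1 → O.valuation x ≤ O.valuation π) ∧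
      (∀ x : K, x ≠ 0 → ∃ n : ℕ, O.valuation π ^ n ≤ O.valuation x)) →
    ∃ (A' : Subalgebra k K), A'.toSubring ≤ O.toSubring ∧ A ≤ A' ∧ A'.FG ∧
    ∃ (_ : IsRegularLocalRing (locAtCentre A'.toSubring O)) (c : Fin p → K), (∃ j : Fin p, (j : ℕ) ≠ 0 ∧ c j ≠ 0) ∧
    ((∃ (d m : ℕ) (hmd : m ≤ d) (t : Fin d → ↥(locAtCentre A'.toSubring O)) (a : Fin m → ℕ) (u : ↥(locAtCentre A'.toSubring O)), IsUnit u ∧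
    Ideal.span (Set.range t) = IsLocalRing.maximalIdeal ↥(locAtCentre A'.toSubring O) ∧
    ringKrullDim ↥(locAtCentre A'.toSubring O) = (d : WithBot ℕ∞) ∧ 0 < m ∧ (∀ i, ¬ p ∣ a i) ∧
    (∑ j : Fin p, c j ^ p * g₀ ^ (j : ℕ)) = (u : K) * ∏ i : Fin m, ((t (Fin.castLE hmd i) : ↥(locAtCentre A'.toSubring O)) : K) ^ (a i)) ∨
    (∃ u : ↥(locAtCentre A'.toSubring O), IsUnit u ∧ (∑ j : Fin p, c j ^ p * g₀ ^ (j : ℕ)) = (u : K) ∧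
    ∀ c' : ↥(locAtCentre A'.toSubring O), u - c' ^ p ∉ IsLocalRing.maximalIdeal ↥(locAtCentre A'.toSubring O)) ∨
    (∃ s c' : ↥(locAtCentre A'.toSubring O), (∑ j : Fin p, c j ^ p * g₀ ^ (j : ℕ)) = (s : K) ∧
    s - c' ^ p ∈ IsLocalRing.maximalIdeal ↥(locAtCentre A'.toSubring O) ∧
    s - c' ^ p ∉ IsLocalRing.maximalIdeal ↥(locAtCentre A'.toSubring O) ^ 2))

/-- The TRANSPORT LEMMA, VERBATIM copy of `Census5DimTransport.RSOPCompletionAtDim` (res-B-lens-1 g3). [folklore] -/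
def RSOPCompletionAtDim (d : ℕ) : Prop :=
    ∀ (S : Type) [CommRing S] [IsLocalRing S] [IsNoetherianRing S], IsRegularLocalRing S →
    ringKrullDim S = (d : WithBot ℕ∞) → 2 ≤ d →
    ∀ π F : S, π ∈ maximalIdeal S → π ∉ maximalIdeal S ^ 2 → F ∈ maximalIdeal S →
    (∀ a b : S, a * π + b * F ∈ maximalIdeal S ^ 2 → b ∈ maximalIdeal S) →
    ∃ t : Fin d → S, (∀ h0 : 0 < d, t ⟨0, h0⟩ = π) ∧ (∀ h1 : 1 < d, t ⟨1, h1⟩ = F) ∧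
      Ideal.span (Set.range t) = maximalIdeal S

/-- THEOREM P in every dimension — VERBATIM copy of `Census5DimTransport.CleanLUArcAllDim` (res-B-lens-1 g3). [folklore] -/
def CleanLUArcAllDim (p : ℕ) : Prop := ∀ d : ℕ, CleanLUArcAtDim p d

/-- **The transport lemma holds** in every dimension (for `d ≤ 1` its hypotheses are contradictory and `2 ≤ d` is not even used). [folklore] -/
theorem rsopCompletionAtDim_holds (d : ℕ) : RSOPCompletionAtDim d := by
  intro S _ _ _ hreg hdim _ π F hπ hπ2 hF hind
  obtain ⟨-, t, h0, h1, ht⟩ := rsop_completion hdim π F hπ hπ2 hF hind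
  exact ⟨t, fun _ => h0 _ rfl, fun _ => h1 _ rfl, ht⟩

/-- **THEOREM P_d + LEMMA D-abs**: `CleanLUArcAtDim p d` holds for every prime `p` and every `d` (the derivation binder of `arcPotential_d`
is discharged by `Lens5.AbsDerivation.absDerivation_of_forall_pow_ne'`, ✓p690461). [folklore] -/
theorem cleanLUArcAtDim_holds (p : ℕ) (hp : p.Prime) (d : ℕ) : CleanLUArcAtDim p d := by
  intro k _ _ K _ _ O A hAO hfg hfrac hdimA hreg hdim hzd g₀ hg hna htd hπ
  exact arcPotential_d p hp d k K O A hAO hfg hfrac hdimA hreg hdim hzd g₀ hg hna htd hπ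
    (Lens5.AbsDerivation.absDerivation_of_forall_pow_ne' p hp k K A hfg hfrac g₀ hg)

/-- **`CleanLUArcAllDim p` — the registrar's dim-free support target (census-4 addendum B §3 / addendum C §1 «one leaf with a plan») PROVED.**
Counted 0; rung B is not proved; nothing here proves resolution of singularities in characteristic `p`. [folklore] -/
theorem cleanLUArcAllDim_holds (p : ℕ) (hp : p.Prime) : CleanLUArcAllDim p := fun d => cleanLUArcAtDim_holds p hp d

/-- Closed form (no parameters) for the file audit: THEOREM P_d for EVERY prime `p` and EVERY dimension `d`. [folklore] -/
def CleanLUArcAllDimAllPrimes : Prop := ∀ p : ℕ, p.Prime → CleanLUArcAllDim p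

/-- `CleanLUArcAllDimAllPrimes` holds (kernel-closed witness). [folklore] -/
theorem cleanLUArcAllDimAllPrimes_holds : CleanLUArcAllDimAllPrimes := fun p hp => cleanLUArcAllDim_holds p hp

/-- Sanity (kernel): at `d = 3` the all-dimension theorem re-proves the binders of the landed port target (`arcPotential` ✓p691218 with the
derivation supplied), i.e. `Census5DimTransport.cleanLUArcAtDim_three`. [folklore] -/
theorem cleanLUArcAtDim_three' (p : ℕ) (hp : p.Prime) : CleanLUArcAtDim p 3 := cleanLUArcAtDim_holds p hp 3

end Summit.ResolutionOfSingularities.ResolutionOfSingularities.Cruxes.DescentPerfectToAll.Lens5ArcAllDim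

end
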